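import Literature.AlgebraicGeometry.ModuliOfAbelianVarieties.SiegelFamilyRealLocusGenericPoints
import Literature.AlgebraicGeometry.ModuliOfAbelianVarieties.SiegelFamilyRealPointsLevelTwoInvariance
import Literature.NumberTheory.ModularForms.SiegelModularFormsDegreeOne
import Mathlib.NumberTheory.Modular
import HarnessLib

/-!
# Goresky–Tai §5, the upper half-plane: the `Γ(2)`-real points of `𝔥_1 = ℍ` are `⋃_{β ∈ SL(2,ℤ)} β · iℝ₊`
# (Lemma 14), `Γ(2)` induces no identifications on `iℝ₊`, whose setwise stabiliser in `SL(2, ℤ)` is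
# `S′ = {±1, ±S}`, and `X(2)_ℝ` is the union of THREE copies of `C_1 ≅ ℝ₊` indexed by `Γ(2)∖SL(2,ℤ)/S′`
# (Theorem 15) — with the elliptic points of `SL(2, ℤ)` (the translates of `i` and of `ρ = e^{2πi/3}`)
# assembled from Mathlib's fundamental domain
# (Goresky–Tai 2003, §5 Lemma 14, Theorem 15)

Topic `Literature/AlgebraicGeometry/ModuliOfAbelianVarieties` (the Siegel-family files, namespace
`Literature.AlgebraicGeometry.ModuliOfAbelianVarieties.SiegelModuli`).  Lane `lit-hodgefound` (Track 2
foundations library), prover seat p15 generation 53, row g53-#1, on top of g51-#5 (PROPOSITION 10: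
`exists_coboundary_of_mem_siegelPrincipalGamma_two`), g51-#9 (LEMMA 13:
`exists_mem_siegelPrincipalGamma_two_smul_smul_eq_negConj_iff`), the tree's degree-one dictionary
`SiegelModularFormsDegreeOne` (`𝔥_1 = ℍ`: `one1`, `toUHP`, `spOfSL`, `slOfSp`, `moeb_spOfSL`) and Mathlib's
`Mathlib.NumberTheory.Modular` (the fundamental domain `𝒟` and the stabilisers `ModularGroup.stabilizer_of_ne`,
`stabilizer_I`, `stabilizer_ρ`).  THEOREMS ONLY: no definition, no instance, no notation, no named fact (net
Literature debt `0`), no `sorry`.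

## Source, VERBATIM

M. Goresky, Y. S. Tai, *The moduli space of real abelian varieties with level structure*, Compositio Math.
**139** (2003) = arXiv:math/0108103, held `paper:arxiv-math_0108103`, §5 (p0009):

«For the upper half-plane `𝔥_1` it is possble to do a little better since the group `Γ(2)/±I` acts freely.
[…] **Lemma 14.** If a point `y ∈ 𝔥_1` is `(Γ(2), τ)`-real, then there exists `β ∈ SL(2, ℤ)` and there
exists `Y ∈ C_1 = ℝ₊` so that `y = β · iY`.  Proof.  Say `ỹ = γy` for some `γ ∈ Γ(2)`.  We consider two
cases: (a) when `y` is not fixed by any element of `SL_2(ℤ)` other than `±I` and (b) when `y` is fixed by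
some other nontrivial element of `SL_2(ℤ)`.  In case (a), the result is just Proposition (add) [= Prop. 10].
Now consider case (b).  There are two classes of elements which are fixed by nontrivial subgroups of
`SL_2(ℤ)`.  These are the translates (by elements of `SL_2(ℤ)`) of `i` and the translates of
`ω = e^{2πi/3}`.  In the first case, `y = β · i` (for some `β ∈ SL_2(ℤ)`) and the conclusion follows.  In
the second case, the stabilizer of `ω` is the subgroup `S = {±I, ±(0 −1; 1 1), ±(−1 −1; 1 0)}`.  Suppose
`y = gω` (for some `g ∈ SL_2(ℤ)`).  We claim that `y` is not `Γ(2)`-real.  Suppose otherwise.  Then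
`ỹ = γy` gives `ω̃ = γ′ω` where `γ′ = g̃⁻¹γg = (g̃⁻¹g) g⁻¹γg ∈ Γ(2)` by Lemma (lem-divisibility).  But
`ω̃ = −ω̄ = jω` where `j = (0 −1; 1 0)`.  So `j⁻¹γ′` stabilizes `ω` or `γ′ = js` for some `s ∈ S`.
However none of these matrices `js` lies in `Γ(2)`, which is a contradiction.»

«The group `Γ(2)` does not induce any identifications on the cone `iC_1`.  However `iC_1` is preserved by
the subgroup `S′ = {±I, ±v}` where `v = (0 −1; 1 0)`.  So we obtain  **Theorem 15.**  The (`τ`-)real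
points of `X = Γ(2)∖𝔥_1` consists of the union of 3 copies of the cone `C_1 ≅ ℝ₊`,
`X_ℝ = ⋃_{β ∈ Γ(2)∖SL_2(ℤ)/S′} β · iC_1`.»

Mathlib (`Mathlib.NumberTheory.Modular`, the fundamental domain `𝒟 = ModularGroup.fd`):
`ModularGroup.exists_smul_mem_fd` («every `z ∈ ℍ` has `g • z ∈ 𝒟`»), `ModularGroup.stabilizer_of_ne` («If
`z ∈ 𝒟` and `z ≠ I, ρ, 1 + ρ`, then the stabilizer of `z` in `SL(2, ℤ)` is `± 1`»), `stabilizer_I`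
(`{±1, ±S}`), `stabilizer_ρ` (`{±1, ±ST, ±T⁻¹S}`; Mathlib's `ρ = UpperHalfPlane.ρ = e^{2πi/3}` is GT's `ω`,
Mathlib's `S = (0 −1; 1 0)` is GT's `j = v`, and `ST = (0 −1; 1 1)`, `T⁻¹S = (−1 −1; 1 0)` are GT's
generators of the stabilizer `S` of `ω`).

## What is proved

Conventions as in g51/g52: `Γ_1 = siegelModularGroup 1 = ι(Sp_2(ℤ))`, `ι = symplecticIntHom 1`,
`Γ_1(2) = siegelPrincipalGamma 1 2`, a point `Ω ∈ 𝔥_1` is `Γ_1(2)`-real iff `ι(γ) • Ω = τΩ = −Ω̄` for some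
`γ ∈ Γ_1(2)`, the slice `β · iC_1` is `{Ω | Re(β⁻¹ • Ω) = 0}`; on Mathlib's side `τ ∈ ℍ` is `Γ(2)`-real iff
`↑(γ • τ) = −conj ↑τ` for some `γ ∈ CongruenceSubgroup.Gamma 2`, and the slice `β · iℝ₊` is
`{τ | (β⁻¹ • τ).re = 0}`.

* §1 THE GENUS-ONE BRIDGE `𝔥_1 = ℍ`, `Γ_1 = SL(2, ℤ)` (element level, on top of the dictionary):
  **`symplecticIntHom_spOfSL_smul_one1`** (`ι(spOfSL γ) • (τ) = (γ • τ)`: the tree's action of `Sp_2(ℤ)` on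
  `𝔥_1` IS Mathlib's action of `SL(2, ℤ)` on `ℍ`), `exists_eq_one1`, `exists_eq_symplecticIntHom_spOfSL`,
  `mk_spOfSL_mem_siegelPrincipalGamma_iff` (`spOfSL γ ∈ Γ_1(N) ⟺ γ ∈ Γ(N)`), the matrices `spOfSL (±1) = ±1`,
  `spOfSL (±S) = ±J`, `symplecticIntHom_spOfSL_smul_one1_eq_negConj_iff` (`ι(spOfSL γ) • (τ) = τ(τ) ⟺
  ↑(γ • τ) = −conj τ`), `map_re_one1_eq_zero_iff`, and the transfer of reality
  **`exists_mem_siegelPrincipalGamma_two_smul_one1_eq_negConj_iff`** (`(τ)` is `Γ_1(2)`-real iff `τ` is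
  `Γ(2)`-real).
* §2 THE ELLIPTIC POINTS OF `SL(2, ℤ)` («two classes … the translates of `i` and the translates of `ω`»):
  **`exists_eq_smul_I_or_eq_smul_rho_of_smul_eq_self`** — if `g • w = w` with `g ≠ ±1` then `w = β • I` or
  `w = β • ρ` for some `β ∈ SL(2, ℤ)`; conversely `smul_I_smul_eq_self`, `smul_rho_smul_eq_self` (the translates
  ARE fixed by the non-trivial elements `βSβ⁻¹`, `βSTβ⁻¹`).
* §3 THE CONE `iℝ₊` AND `S′ = {±1, ±S}`: **`eq_one_or_eq_neg_one_or_eq_S_or_eq_neg_S_of_re_smul_eq_zero`**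
  (if `Re τ = 0` and `Re(γ • τ) = 0` for `γ ∈ SL(2, ℤ)` then `γ ∈ S′` — «`iC_1` is preserved by the subgroup
  `S′`», and by nothing else), `re_S_smul_eq_zero` (`S` does preserve `iℝ₊`), **`smul_eq_self_of_mem_Gamma_two`**
  («`Γ(2)` does not induce any identifications on the cone `iC_1`»), `neg_conj_coe_eq_self_iff`
  (`−conj τ = τ ⟺ Re τ = 0`: the points of `iℝ₊` are `Γ(2)`-real with `γ = 1`).
* §4 `ρ` IS NOT `Γ(2)`-REAL: `not_exists_mem_Gamma_two_smul_rho` («none of these matrices `js` lies in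
  `Γ(2)`», by `decide` on the six elements of Mathlib's `stabilizer_ρ` translated by `T`:
  `−conj ρ = ρ + 1 = T • ρ`), and its transport `not_exists_mem_siegelPrincipalGamma_two_smul_one1_rho`;
  by LEMMA 13 no translate `β • ρ` is `Γ(2)`-real: **`not_real_smul_rho`**.
* §5 **LEMMA 14**: **`exists_re_inv_smul_eq_zero_of_real`** (`τ` `Γ(2)`-real ⟹ `Re(β⁻¹ • τ) = 0` for some
  `β ∈ SL(2, ℤ)`, i.e. `τ = β · iY`) and the Siegel form
  **`exists_mem_siegelModularGroup_map_re_inv_smul_eq_zero_of_real`** (`Ω ∈ 𝔥_1` `Γ_1(2)`-real ⟹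
  `Re(β⁻¹ • Ω) = 0` for some `β ∈ Γ_1`).  Case (a) is PROPOSITION 10 (g51-#5) at `g = 1` through the bridge;
  case (b) is §2 + §4.
* §6 **THEOREM 15**: (i) **`real_iff_exists_re_inv_smul_eq_zero`** / Siegel
  **`real_iff_exists_mem_siegelModularGroup_map_re_inv_smul_eq_zero`** — the real locus is EXACTLY
  `⋃_β β · iC_1` (⟸ by LEMMA 13, g51-#9); (ii) the Siegel form of §3:
  **`coe_eq_of_map_re_eq_zero_of_map_re_smul_eq_zero`** (`P ∈ Γ_1` carrying a point of `iC_1` into `iC_1`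
  is `±1` or `±J`) and **`smul_eq_self_of_mem_siegelPrincipalGamma_two_of_map_re_eq_zero`** (no
  identifications by `Γ_1(2)`); (iii) the index set `Γ(2)∖SL_2(ℤ)/S′`: two slices `β · iℝ₊`, `β′ · iℝ₊` are
  identified by `Γ(2)` iff `β′ ∈ Γ(2) β S′` (**`exists_mem_Gamma_two_smul_smul_eq_smul_iff`**), iff `β′ ≡ β` or
  `β′ ≡ βS (mod 2)` (`exists_mem_Gamma_two_eq_mul_iff_map_eq`, reduction `SL(2, ℤ) → SL(2, ℤ/2)`, a group of
  order `6`), there are exactly THREE classes, with representatives `1`, `T`, `ST`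
  (**`exists_mem_Gamma_two_eq_rep_mul`**, **`not_exists_mem_Gamma_two_rep_eq_mul`**), hence
  **`exists_mem_Gamma_two_eq_smul_rep_smul_of_real`** («`X_ℝ = ⋃_{β ∈ Γ(2)∖SL_2(ℤ)/S′} β · iC_1`»: every
  `Γ(2)`-real `τ` is `γ • r • iY` with `γ ∈ Γ(2)`, `r ∈ {1, T, ST}`), the three slices `iℝ₊`, `T · iℝ₊`,
  `ST · iℝ₊` are pairwise NOT identified by `Γ(2)` (**`not_exists_mem_Gamma_two_smul_rep_smul_eq`**) and each
  maps injectively to `X(2)` (**`eq_of_mem_Gamma_two_smul_smul_eq_smul`**) — «3 copies of the cone `C_1 ≅ ℝ₊`».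

## References

* [GoreskyTai2003RealModuli] M. Goresky, Y. S. Tai, Compositio Math. 139 (2003) 1–27 (arXiv:math/0108103),
  §5 Lemma 14, Theorem 15 (p0009); §4 Prop. 10, Lemma 13.
* [Serre1973CourseArithmetic] J.-P. Serre, *A Course in Arithmetic*, GTM 7, Ch. VII §1.2 Theorem 1 (the
  fundamental domain and the stabilisers of `i`, `ρ`, `−ρ̄`) — as formalised in `Mathlib.NumberTheory.Modular`.
* [DiamondShurman2005] F. Diamond, J. Shurman, GTM 228, §2.3 (elliptic points of `SL_2(ℤ)`: the orbits of `i`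
  and `μ_3`), Exercise 2.3.7.
-/

noncomputable section

open scoped Matrix MatrixGroups UpperHalfPlane Modular ComplexConjugate
open Matrix Function

namespace Literature.AlgebraicGeometry.ModuliOfAbelianVarieties

namespace SiegelModuli

open Literature.NumberTheory.Automorphic (siegelUpperHalfSpace)
open Literature.NumberTheory.ModularForms.SiegelUpperHalfSpace (symplecticIntHom siegelModularGroup
  symplecticIntHom_injective moeb coe_smul)
open Literature.NumberTheory.ModularForms.SiegelModularForm (siegelPrincipalGamma mem_siegelPrincipalGamma_iff_forall
  one1 one1_apply eq_one1 toUHP coe_toUHP one1_toUHP toUHP_one1 one1_coe_mem spOfSL spOfSL_mem slOfSp spOfSL_slOfSp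
  slOfSp_spOfSL moeb_spOfSL mem_siegelUpperHalfSpace_one_iff one1_injective symplecticGroupFinOneEquiv)

/-! ## §1 The genus-one bridge: `𝔥_1 = ℍ`, `Γ_1 = Sp_2(ℤ) = SL(2, ℤ)`, levels and `τΩ = −Ω̄` -/

section Bridge

/-- **The tree's action of `Sp_2(ℤ)` on `𝔥_1` is Mathlib's action of `SL(2, ℤ)` on `ℍ`**:
`ι(spOfSL γ) • (τ) = (γ • τ)` (the dictionary's `moeb_spOfSL`, `m⟨z⟩ = (az + b)(cz + d)⁻¹`).
[cite: GoreskyTai2003RealModuli, §5 («For the upper half-plane `𝔥_1` …»)] -/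
theorem symplecticIntHom_spOfSL_smul_one1 (γ : SL(2, ℤ)) (τ : ℍ) :
    symplecticIntHom 1 ⟨spOfSL γ, spOfSL_mem γ⟩ • (⟨one1 (τ : ℂ), one1_coe_mem τ⟩ : siegelUpperHalfSpace 1) =
      ⟨one1 ((γ • τ : ℍ) : ℂ), one1_coe_mem (γ • τ)⟩ := by
  apply Subtype.ext
  rw [coe_smul]
  change moeb (((spOfSL γ).map (Int.castRingHom ℝ)).map ((↑) : ℝ → ℂ)) (one1 (τ : ℂ)) = one1 ((γ • τ : ℍ) : ℂ)
  rw [Matrix.map_map]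
  have h : ((↑) : ℝ → ℂ) ∘ (Int.castRingHom ℝ) = ((↑) : ℤ → ℂ) := funext fun z ↦ by simp
  rw [h]
  exact moeb_spOfSL γ τ

/-- Every point of `𝔥_1` is `(τ)` for a point `τ` of Mathlib's `ℍ`. [cite: GoreskyTai2003RealModuli, §5] -/
theorem exists_eq_one1 (Ω : siegelUpperHalfSpace 1) :
    ∃ τ : ℍ, Ω = ⟨one1 (τ : ℂ), one1_coe_mem τ⟩ :=
  ⟨toUHP _ Ω.2, Subtype.ext (one1_toUHP Ω.2).symm⟩

/-- `spOfSL (slOfSp M) = M` in `Sp_2(ℤ)`. [cite: GoreskyTai2003RealModuli, §5] -/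
theorem mk_spOfSL_slOfSp (M : Matrix.symplecticGroup (Fin 1) ℤ) :
    (⟨spOfSL (slOfSp M.1 M.2), spOfSL_mem _⟩ : Matrix.symplecticGroup (Fin 1) ℤ) = M :=
  Subtype.ext (spOfSL_slOfSp M.2)

/-- Every element of `Γ_1 = ι(Sp_2(ℤ))` is `ι(spOfSL γ)` for some `γ ∈ SL(2, ℤ)`. [cite: GoreskyTai2003RealModuli, §5] -/
theorem exists_eq_symplecticIntHom_spOfSL {P : Matrix.symplecticGroup (Fin 1) ℝ} (hP : P ∈ siegelModularGroup 1) :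
    ∃ γ : SL(2, ℤ), P = symplecticIntHom 1 ⟨spOfSL γ, spOfSL_mem γ⟩ := by
  obtain ⟨M, rfl⟩ := MonoidHom.mem_range.1 hP
  exact ⟨slOfSp M.1 M.2, by rw [mk_spOfSL_slOfSp]⟩

/-- `ι(spOfSL γ) ∈ Γ_1`. [cite: GoreskyTai2003RealModuli, §5] -/
theorem symplecticIntHom_spOfSL_mem (γ : SL(2, ℤ)) :
    symplecticIntHom 1 ⟨spOfSL γ, spOfSL_mem γ⟩ ∈ siegelModularGroup 1 :=
  MonoidHom.mem_range.2 ⟨_, rfl⟩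

/-- `γ ↦ spOfSL γ` is multiplicative (the inverse of the dictionary's `Sp_2(ℤ) ≃* SL(2, ℤ)`).
[cite: GoreskyTai2003RealModuli, §5] -/
theorem mk_spOfSL_mul (γ γ' : SL(2, ℤ)) :
    (⟨spOfSL (γ * γ'), spOfSL_mem _⟩ : Matrix.symplecticGroup (Fin 1) ℤ) =
      ⟨spOfSL γ, spOfSL_mem γ⟩ * ⟨spOfSL γ', spOfSL_mem γ'⟩ := by
  apply Subtype.ext
  change spOfSL (γ * γ') = spOfSL γ * spOfSL γ'
  ext i j
  rcases i with i | i <;> rcases j with j | j <;>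
    simp [spOfSL, Matrix.mul_apply, Fintype.sum_sum_type, Subsingleton.elim i 0, Subsingleton.elim j 0,
      Matrix.mul_apply, Fin.sum_univ_two]

/-- `spOfSL 1 = 1`. [cite: GoreskyTai2003RealModuli, §5] -/
theorem spOfSL_one : spOfSL 1 = 1 := by
  ext (i | i) (j | j)
  · rw [Subsingleton.elim i j]; simp [spOfSL]
  · simp [spOfSL]
  · simp [spOfSL]
  · rw [Subsingleton.elim i j]; simp [spOfSL]

/-- `spOfSL 1 = 1` in `Sp_2(ℤ)`. [cite: GoreskyTai2003RealModuli, §5] -/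
theorem mk_spOfSL_one : (⟨spOfSL 1, spOfSL_mem 1⟩ : Matrix.symplecticGroup (Fin 1) ℤ) = 1 :=
  Subtype.ext spOfSL_one

/-- `spOfSL β⁻¹ = (spOfSL β)⁻¹` in `Sp_2(ℤ)`. [cite: GoreskyTai2003RealModuli, §5] -/
theorem mk_spOfSL_inv (β : SL(2, ℤ)) :
    (⟨spOfSL β⁻¹, spOfSL_mem β⁻¹⟩ : Matrix.symplecticGroup (Fin 1) ℤ) = ⟨spOfSL β, spOfSL_mem β⟩⁻¹ := by
  rw [eq_inv_iff_mul_eq_one, ← mk_spOfSL_mul, inv_mul_cancel, mk_spOfSL_one]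

/-- `ι(spOfSL β)⁻¹ = ι(spOfSL β⁻¹)`. [cite: GoreskyTai2003RealModuli, §5] -/
theorem symplecticIntHom_spOfSL_inv (β : SL(2, ℤ)) :
    (symplecticIntHom 1 ⟨spOfSL β, spOfSL_mem β⟩)⁻¹ = symplecticIntHom 1 ⟨spOfSL β⁻¹, spOfSL_mem β⁻¹⟩ := by
  rw [mk_spOfSL_inv, map_inv]

/-- `spOfSL (−γ) = −spOfSL γ`. [cite: GoreskyTai2003RealModuli, §5] -/
theorem spOfSL_neg (γ : SL(2, ℤ)) : spOfSL (-γ) = -spOfSL γ := by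
  ext i j
  rcases i with i | i <;> rcases j with j | j <;>
    simp [spOfSL, Subsingleton.elim i 0, Subsingleton.elim j 0]

/-- **GT's `v = j = (0 −1; 1 0)` is Mathlib's `S`, and `spOfSL S = J`** (the standard symplectic matrix of
`Sp_2`). [cite: GoreskyTai2003RealModuli, §5 («`v = (0 −1; 1 0)`»)] -/
theorem spOfSL_S : spOfSL ModularGroup.S = Matrix.J (Fin 1) ℤ := by
  ext i j
  rcases i with i | i <;> rcases j with j | j <;>
    simp [spOfSL, Matrix.J, ModularGroup.coe_S, Subsingleton.elim i 0, Subsingleton.elim j 0]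

/-- `ι(spOfSL γ) = ι(spOfSL γ′) ⟺ γ = γ′`. [cite: GoreskyTai2003RealModuli, §5] -/
theorem symplecticIntHom_spOfSL_inj {γ γ' : SL(2, ℤ)} :
    symplecticIntHom 1 ⟨spOfSL γ, spOfSL_mem γ⟩ = symplecticIntHom 1 ⟨spOfSL γ', spOfSL_mem γ'⟩ ↔ γ = γ' := by
  constructor
  · intro h
    exact symplecticGroupFinOneEquiv.symm.injective (symplecticIntHom_injective h)
  · rintro rfl; rfl

/-- The matrix of `ι(spOfSL 1)` is `1`. [cite: GoreskyTai2003RealModuli, §5] -/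
theorem coe_symplecticIntHom_spOfSL_one :
    ((symplecticIntHom 1 ⟨spOfSL 1, spOfSL_mem 1⟩ : Matrix.symplecticGroup (Fin 1) ℝ) :
      Matrix (Fin 1 ⊕ Fin 1) (Fin 1 ⊕ Fin 1) ℝ) = 1 := by
  change (spOfSL 1).map (Int.castRingHom ℝ) = 1
  rw [spOfSL_one, Matrix.map_one _ (map_zero _) (map_one _)]

/-- The matrix of `ι(spOfSL (−γ))` is minus that of `ι(spOfSL γ)`. [cite: GoreskyTai2003RealModuli, §5] -/
theorem coe_symplecticIntHom_spOfSL_neg (γ : SL(2, ℤ)) :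
    ((symplecticIntHom 1 ⟨spOfSL (-γ), spOfSL_mem (-γ)⟩ : Matrix.symplecticGroup (Fin 1) ℝ) :
      Matrix (Fin 1 ⊕ Fin 1) (Fin 1 ⊕ Fin 1) ℝ) =
      -((symplecticIntHom 1 ⟨spOfSL γ, spOfSL_mem γ⟩ : Matrix.symplecticGroup (Fin 1) ℝ) :
        Matrix (Fin 1 ⊕ Fin 1) (Fin 1 ⊕ Fin 1) ℝ) := by
  change (spOfSL (-γ)).map (Int.castRingHom ℝ) = -(spOfSL γ).map (Int.castRingHom ℝ)
  rw [spOfSL_neg, Matrix.map_neg _ (map_neg (Int.castRingHom ℝ))]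

/-- The matrix of `ι(spOfSL S)` is `J`. [cite: GoreskyTai2003RealModuli, §5 («`v = (0 −1; 1 0)`»)] -/
theorem coe_symplecticIntHom_spOfSL_S :
    ((symplecticIntHom 1 ⟨spOfSL ModularGroup.S, spOfSL_mem _⟩ : Matrix.symplecticGroup (Fin 1) ℝ) :
      Matrix (Fin 1 ⊕ Fin 1) (Fin 1 ⊕ Fin 1) ℝ) = Matrix.J (Fin 1) ℝ := by
  change (spOfSL ModularGroup.S).map (Int.castRingHom ℝ) = Matrix.J (Fin 1) ℝ
  rw [spOfSL_S]
  ext i j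
  rcases i with i | i <;> rcases j with j | j <;>
    simp [Matrix.J, Subsingleton.elim i 0, Subsingleton.elim j 0]

/-- **Levels agree**: `spOfSL γ ∈ Γ_1(N) = ker(Sp_2(ℤ) → Sp_2(ℤ/N)) ⟺ γ ∈ Γ(N) ≤ SL(2, ℤ)` (Mathlib's
`CongruenceSubgroup.Gamma`). [cite: GoreskyTai2003RealModuli, §4.1 («`Γ(N) = {γ ∈ Γ(1) | γ ≡ I (mod N)}`»)] -/
theorem mk_spOfSL_mem_siegelPrincipalGamma_iff {N : ℕ} (γ : SL(2, ℤ)) :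
    (⟨spOfSL γ, spOfSL_mem γ⟩ : Matrix.symplecticGroup (Fin 1) ℤ) ∈ siegelPrincipalGamma 1 N ↔
      γ ∈ CongruenceSubgroup.Gamma N := by
  rw [mem_siegelPrincipalGamma_iff_forall, CongruenceSubgroup.Gamma_mem]
  simp only [Sum.forall, Fin.forall_fin_one]
  simp [spOfSL, Matrix.one_apply_ne, Matrix.one_apply_eq]
  tauto

/-- Existential statements over `Γ_1(N)` are existential statements over `Γ(N)`.
[cite: GoreskyTai2003RealModuli, §4.1, §5] -/
theorem exists_mem_siegelPrincipalGamma_one_iff {N : ℕ} (p : Matrix.symplecticGroup (Fin 1) ℤ → Prop) :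
    (∃ γ ∈ siegelPrincipalGamma 1 N, p γ) ↔
      ∃ g ∈ CongruenceSubgroup.Gamma N, p ⟨spOfSL g, spOfSL_mem g⟩ := by
  constructor
  · rintro ⟨γ, hγ, hp⟩
    refine ⟨slOfSp γ.1 γ.2, (mk_spOfSL_mem_siegelPrincipalGamma_iff _).1 ?_, ?_⟩ <;> rwa [mk_spOfSL_slOfSp]
  · rintro ⟨g, hg, hp⟩
    exact ⟨_, (mk_spOfSL_mem_siegelPrincipalGamma_iff g).2 hg, hp⟩

/-- `Re (z) = 0 ⟺ Re z = 0` for the `1 × 1` matrix `(z)`. [cite: GoreskyTai2003RealModuli, §5 («`C_1 = ℝ₊`»)] -/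
theorem map_re_one1_eq_zero_iff (z : ℂ) : (one1 z).map Complex.re = 0 ↔ z.re = 0 := by
  constructor
  · intro h
    have h00 := congr_fun (congr_fun h 0) 0
    simpa using h00
  · intro h
    ext i j
    simp [h]

/-- `Re (τ) = 0 ⟺ Re τ = 0` for `τ ∈ ℍ`. [cite: GoreskyTai2003RealModuli, §5 («`C_1 = ℝ₊`»)] -/
theorem map_re_one1_coe_eq_zero_iff (τ : ℍ) : (one1 (τ : ℂ)).map Complex.re = 0 ↔ τ.re = 0 := by
  rw [map_re_one1_eq_zero_iff, UpperHalfPlane.coe_re]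

/-- **`ι(spOfSL γ) • (τ) = (τ′) ⟺ γ • τ = τ′`.** [cite: GoreskyTai2003RealModuli, §5] -/
theorem symplecticIntHom_spOfSL_smul_one1_eq_one1_iff (γ : SL(2, ℤ)) (τ τ' : ℍ) :
    symplecticIntHom 1 ⟨spOfSL γ, spOfSL_mem γ⟩ • (⟨one1 (τ : ℂ), one1_coe_mem τ⟩ : siegelUpperHalfSpace 1) =
        ⟨one1 (τ' : ℂ), one1_coe_mem τ'⟩ ↔ γ • τ = τ' := by
  rw [symplecticIntHom_spOfSL_smul_one1, Subtype.mk.injEq, one1_injective.eq_iff, UpperHalfPlane.ext_iff]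

/-- **`ι(spOfSL γ) • (τ) = τ(τ) = −(τ̄) ⟺ ↑(γ • τ) = −conj τ`**: the tree's reality equation at the point
`(τ) ∈ 𝔥_1` is the equation `γτ = −τ̄` in `ℍ`. [cite: GoreskyTai2003RealModuli, §4.1 («`γZ = −Z̄`»), §5] -/
theorem symplecticIntHom_spOfSL_smul_one1_eq_negConj_iff (γ : SL(2, ℤ)) (τ : ℍ) :
    symplecticIntHom 1 ⟨spOfSL γ, spOfSL_mem γ⟩ • (⟨one1 (τ : ℂ), one1_coe_mem τ⟩ : siegelUpperHalfSpace 1) =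
        ⟨-(one1 (τ : ℂ)).map conj, neg_map_conj_mem_siegelUpperHalfSpace (one1_coe_mem τ)⟩ ↔
      ((γ • τ : ℍ) : ℂ) = -conj (τ : ℂ) := by
  rw [symplecticIntHom_spOfSL_smul_one1, Subtype.mk.injEq]
  constructor
  · intro h
    have h00 := congr_fun (congr_fun h 0) 0
    simpa only [one1_apply, Matrix.neg_apply, Matrix.map_apply] using h00
  · intro h
    ext i j
    simp only [one1_apply, Matrix.neg_apply, Matrix.map_apply]
    exact h

/-- **Transfer of reality**: `(τ) ∈ 𝔥_1` is `Γ_1(2)`-real (`ι(γ) • (τ) = −(τ̄)` for some `γ ∈ Γ_1(2)`) iff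
`τ ∈ ℍ` is `Γ(2)`-real (`↑(g • τ) = −conj τ` for some `g ∈ Γ(2) ≤ SL(2, ℤ)`).
[cite: GoreskyTai2003RealModuli, §4.1 («`[Z] ∈ X_ℝ` iff there exists `γ ∈ Γ(4m)` such that `γZ = −Z̄`»), §5] -/
theorem exists_mem_siegelPrincipalGamma_two_smul_one1_eq_negConj_iff {N : ℕ} (τ : ℍ) :
    (∃ γ ∈ siegelPrincipalGamma 1 N, symplecticIntHom 1 γ •
        (⟨one1 (τ : ℂ), one1_coe_mem τ⟩ : siegelUpperHalfSpace 1) =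
          ⟨-(one1 (τ : ℂ)).map conj, neg_map_conj_mem_siegelUpperHalfSpace (one1_coe_mem τ)⟩) ↔
      ∃ g ∈ CongruenceSubgroup.Gamma N, ((g • τ : ℍ) : ℂ) = -conj (τ : ℂ) := by
  rw [exists_mem_siegelPrincipalGamma_one_iff]
  simp only [symplecticIntHom_spOfSL_smul_one1_eq_negConj_iff]

end Bridge

/-! ## §2 The elliptic points of `SL(2, ℤ)`: the translates of `i` and of `ρ = ω = e^{2πi/3}` -/

section Elliptic

/-- **THE POINTS OF `ℍ` WITH NON-TRIVIAL STABILISER IN `SL(2, ℤ)` ARE THE TRANSLATES OF `i` AND OF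
`ω = e^{2πi/3}`**: if `g • w = w` with `g ≠ ±1` then `w = β • i` or `w = β • ρ` for some `β ∈ SL(2, ℤ)`
(«There are two classes of elements which are fixed by nontrivial subgroups of `SL_2(ℤ)`.  These are the
translates (by elements of `SL_2(ℤ)`) of `i` and the translates of `ω = e^{2πi/3}`»).  Proof: move `w` into
Mathlib's fundamental domain `𝒟` by `h`, so `hgh⁻¹ ≠ ±1` fixes `h • w ∈ 𝒟`; by `ModularGroup.stabilizer_of_ne`,
`h • w ∈ {i, ρ, 1 + ρ = T • ρ}`.
[cite: GoreskyTai2003RealModuli, §5 proof of Lemma 14] [cite: Serre1973CourseArithmetic, Ch. VII §1.2 Theorem 1] -/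
theorem exists_eq_smul_I_or_eq_smul_rho_of_smul_eq_self {g : SL(2, ℤ)} {w : ℍ} (hw : g • w = w)
    (h1 : g ≠ 1) (h2 : g ≠ -1) :
    ∃ β : SL(2, ℤ), w = β • UpperHalfPlane.I ∨ w = β • UpperHalfPlane.ρ := by
  obtain ⟨h, hh⟩ := ModularGroup.exists_smul_mem_fd w
  have hfix : (h * g * h⁻¹) • (h • w) = h • w := by
    rw [mul_smul, mul_smul, inv_smul_smul, hw]
  have hconj : g = h⁻¹ * (h * g * h⁻¹) * h := by group
  have h1' : h * g * h⁻¹ ≠ 1 := by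
    intro e; apply h1; rw [hconj, e]; group
  have h2' : h * g * h⁻¹ ≠ -1 := by
    intro e; apply h2; rw [hconj, e]; simp
  by_cases hI : h • w = UpperHalfPlane.I
  · exact ⟨h⁻¹, Or.inl (by rw [← hI, inv_smul_smul])⟩
  by_cases hρ : h • w = UpperHalfPlane.ρ
  · exact ⟨h⁻¹, Or.inr (by rw [← hρ, inv_smul_smul])⟩
  by_cases hρ' : h • w = (1 : ℝ) +ᵥ UpperHalfPlane.ρ
  · refine ⟨h⁻¹ * ModularGroup.T, Or.inr ?_⟩
    rw [mul_smul, UpperHalfPlane.modular_T_smul, ← hρ', inv_smul_smul]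
  rcases ModularGroup.stabilizer_of_ne hh hfix hI hρ hρ' with e | e
  · exact absurd e h1'
  · exact absurd e h2'

/-- Conversely **the translates of `i` are elliptic**: `βSβ⁻¹ ≠ ±1` fixes `β • i` (Mathlib's `stabilizer_I`:
the stabiliser of `i` is `{±1, ±S}`). [cite: GoreskyTai2003RealModuli, §5 proof of Lemma 14] [cite: Serre1973CourseArithmetic, Ch. VII §1.2 Theorem 1] -/
theorem smul_I_smul_eq_self (β : SL(2, ℤ)) :
    (β * ModularGroup.S * β⁻¹) • β • UpperHalfPlane.I = β • UpperHalfPlane.I ∧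
      β * ModularGroup.S * β⁻¹ ≠ 1 ∧ β * ModularGroup.S * β⁻¹ ≠ -1 := by
  have hS : ModularGroup.S • UpperHalfPlane.I = UpperHalfPlane.I :=
    ModularGroup.stabilizer_I.2 (by simp)
  have hconj : ModularGroup.S = β⁻¹ * (β * ModularGroup.S * β⁻¹) * β := by group
  refine ⟨by rw [mul_smul, mul_smul, inv_smul_smul, hS], fun e ↦ ?_, fun e ↦ ?_⟩
  · apply (show ModularGroup.S ≠ (1 : SL(2, ℤ)) by decide)
    rw [hconj, e]; group
  · apply (show ModularGroup.S ≠ (-1 : SL(2, ℤ)) by decide)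
    rw [hconj, e]; simp

/-- … and **the translates of `ω = ρ` are elliptic**: `β(ST)β⁻¹ ≠ ±1` fixes `β • ρ` (Mathlib's
`stabilizer_ρ`: the stabiliser of `ρ` is `{±1, ±ST, ±T⁻¹S}` — GT's `S = {±I, ±(0 −1; 1 1), ±(−1 −1; 1 0)}`).
[cite: GoreskyTai2003RealModuli, §5 proof of Lemma 14 («the stabilizer of `ω` is the subgroup `S`»)] -/
theorem smul_rho_smul_eq_self (β : SL(2, ℤ)) :
    (β * (ModularGroup.S * ModularGroup.T) * β⁻¹) • β • UpperHalfPlane.ρ = β • UpperHalfPlane.ρ ∧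
      β * (ModularGroup.S * ModularGroup.T) * β⁻¹ ≠ 1 ∧ β * (ModularGroup.S * ModularGroup.T) * β⁻¹ ≠ -1 := by
  have hST : (ModularGroup.S * ModularGroup.T) • UpperHalfPlane.ρ = UpperHalfPlane.ρ :=
    ModularGroup.stabilizer_ρ.2 (by simp)
  have hconj : ModularGroup.S * ModularGroup.T =
      β⁻¹ * (β * (ModularGroup.S * ModularGroup.T) * β⁻¹) * β := by group
  refine ⟨by rw [mul_smul, mul_smul, inv_smul_smul, hST], fun e ↦ ?_, fun e ↦ ?_⟩
  · apply (show ModularGroup.S * ModularGroup.T ≠ (1 : SL(2, ℤ)) by decide)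
    rw [hconj, e]; group
  · apply (show ModularGroup.S * ModularGroup.T ≠ (-1 : SL(2, ℤ)) by decide)
    rw [hconj, e]; simp

end Elliptic

/-! ## §3 The cone `iC_1 = iℝ₊` and its stabiliser `S′ = {±1, ±S}` in `SL(2, ℤ)`; no identifications by `Γ(2)` -/

section Cone

/-- **`iC_1` is preserved by `S′ = {±I, ±v}` AND BY NOTHING ELSE in `SL(2, ℤ)`**: if `Re τ = 0` and
`Re(γ • τ) = 0` then `γ ∈ {±1, ±S}`.  Proof: write `τ = iY`, `γτ = iW` (`Y, W > 0`), `γ = (a b; c d)`; from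
`iW(ciY + d) = aiY + b`: `b = −cWY`, `dW = aY`, so `ad ≥ 0 ≥ bc`; with `ad − bc = 1` either `ad = 1`,
`bc = 0` (then `c = b = 0`, `γ = ±1`) or `ad = 0`, `bc = −1` (then `a = d = 0`, `γ = ±S`).
[cite: GoreskyTai2003RealModuli, §5 («`iC_1` is preserved by the subgroup `S′ = {±I, ±v}` where `v = (0 −1; 1 0)`»)] -/
theorem eq_one_or_eq_neg_one_or_eq_S_or_eq_neg_S_of_re_smul_eq_zero {γ : SL(2, ℤ)} {τ : ℍ}
    (hτ : τ.re = 0) (hγτ : (γ • τ).re = 0) :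
    γ = 1 ∨ γ = -1 ∨ γ = ModularGroup.S ∨ γ = -ModularGroup.S := by
  have hd : (γ 1 0 : ℂ) * τ + γ 1 1 ≠ 0 := by
    have := UpperHalfPlane.denom_ne_zero (γ : GL (Fin 2) ℝ) τ
    rwa [ModularGroup.denom_apply] at this
  have hw : ((γ • τ : ℍ) : ℂ) * ((γ 1 0 : ℂ) * τ + γ 1 1) = (γ 0 0 : ℂ) * τ + γ 0 1 := by
    rw [UpperHalfPlane.coe_specialLinearGroup_apply]
    simp only [algebraMap_int_eq, Int.coe_castRingHom, Complex.ofReal_intCast]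
    exact div_mul_cancel₀ _ hd
  have hτ' : (τ : ℂ).re = 0 := by rw [UpperHalfPlane.coe_re]; exact hτ
  have hw' : ((γ • τ : ℍ) : ℂ).re = 0 := by rw [UpperHalfPlane.coe_re]; exact hγτ
  have hY : 0 < (τ : ℂ).im := τ.im_pos
  have hW : 0 < ((γ • τ : ℍ) : ℂ).im := (γ • τ).im_pos
  have hre := congrArg Complex.re hw
  have him := congrArg Complex.im hw
  simp only [Complex.mul_re, Complex.mul_im, Complex.add_re, Complex.add_im, Complex.intCast_re,
    Complex.intCast_im, hτ', hw', zero_mul, mul_zero, sub_zero, zero_add, add_zero, zero_sub] at hre him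
  -- `hre : -(W * (c * Y)) = b`, `him : W * d = a * Y` (up to normal form)
  set W := ((γ • τ : ℍ) : ℂ).im with hWdef
  set Y := (τ : ℂ).im with hYdef
  have e1 : ((γ 0 1 : ℤ) : ℝ) = -(W * (γ 1 0 : ℤ) * Y) := by linarith
  have e2 : W * ((γ 1 1 : ℤ) : ℝ) = ((γ 0 0 : ℤ) : ℝ) * Y := by linarith
  have hdet : (γ 0 0 : ℤ) * γ 1 1 - γ 0 1 * γ 1 0 = 1 := by
    have := γ.det_coe
    rw [Matrix.det_fin_two] at this
    exact this
  -- `ad ≥ 0`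
  have had : 0 ≤ (γ 0 0 : ℤ) * γ 1 1 := by
    have h1 : ((γ 0 0 : ℤ) : ℝ) * (γ 1 1 : ℤ) * Y = W * (γ 1 1 : ℤ) * (γ 1 1 : ℤ) := by
      calc ((γ 0 0 : ℤ) : ℝ) * (γ 1 1 : ℤ) * Y = (((γ 0 0 : ℤ) : ℝ) * Y) * (γ 1 1 : ℤ) := by ring
        _ = (W * (γ 1 1 : ℤ)) * (γ 1 1 : ℤ) := by rw [e2]
        _ = W * (γ 1 1 : ℤ) * (γ 1 1 : ℤ) := by ring
    have h2 : 0 ≤ ((γ 0 0 : ℤ) : ℝ) * (γ 1 1 : ℤ) * Y := by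
      rw [h1]; nlinarith [mul_self_nonneg ((γ 1 1 : ℤ) : ℝ), hW.le]
    have h3 : 0 ≤ ((γ 0 0 : ℤ) : ℝ) * (γ 1 1 : ℤ) := by nlinarith
    exact_mod_cast h3
  -- `bc ≤ 0`
  have hbc : (γ 0 1 : ℤ) * γ 1 0 ≤ 0 := by
    have h1 : ((γ 0 1 : ℤ) : ℝ) * (γ 1 0 : ℤ) = -(W * Y * ((γ 1 0 : ℤ) * (γ 1 0 : ℤ))) := by
      rw [e1]; ring
    have h2 : ((γ 0 1 : ℤ) : ℝ) * (γ 1 0 : ℤ) ≤ 0 := by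
      rw [h1]; nlinarith [mul_self_nonneg ((γ 1 0 : ℤ) : ℝ), mul_pos hW hY]
    exact_mod_cast h2
  -- hence `ad ∈ {0, 1}`
  generalize hp : (γ 0 0 : ℤ) * γ 1 1 = p at had hdet
  generalize hq : (γ 0 1 : ℤ) * γ 1 0 = q at hbc hdet
  have hcases : (p = 1 ∧ q = 0) ∨ (p = 0 ∧ q = -1) := by omega
  rcases hcases with ⟨hp1, hq0⟩ | ⟨hp0, hq1⟩
  · -- `ad = 1`, `bc = 0`: `c = 0`, `b = 0`, `a = d = ±1`
    subst hp1 hq0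
    have hc : (γ 1 0 : ℤ) = 0 := by
      rcases mul_eq_zero.1 hq with hb | hc
      · -- `b = 0 ⟹ cWY = 0 ⟹ c = 0`
        have : W * ((γ 1 0 : ℤ) : ℝ) * Y = 0 := by
          have e1' := e1; rw [hb] at e1'; push_cast at e1'; linarith
        have hWY : W * Y ≠ 0 := (mul_pos hW hY).ne'
        have : ((γ 1 0 : ℤ) : ℝ) = 0 := by
          rcases mul_eq_zero.1 this with h | h
          · rcases mul_eq_zero.1 h with h' | h'
            · exact absurd h' hW.ne'
            · exact h'
          · exact absurd h hY.ne'
        exact_mod_cast this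
      · exact hc
    have hb : (γ 0 1 : ℤ) = 0 := by
      have e1' := e1; rw [hc] at e1'; push_cast at e1'
      have : ((γ 0 1 : ℤ) : ℝ) = 0 := by linarith
      exact_mod_cast this
    rcases Int.eq_one_or_neg_one_of_mul_eq_one' hp with ⟨ha, hd'⟩ | ⟨ha, hd'⟩
    · refine Or.inl ?_
      ext i j
      fin_cases i <;> fin_cases j <;> simp [ha, hb, hc, hd']
    · refine Or.inr (Or.inl ?_)
      ext i j
      fin_cases i <;> fin_cases j <;> simp [ha, hb, hc, hd']
  · -- `ad = 0`, `bc = −1`: `a = d = 0`, `(b, c) = ∓(1, −1)`: `γ = ±S`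
    subst hp0 hq1
    have had0 : (γ 0 0 : ℤ) = 0 ∧ (γ 1 1 : ℤ) = 0 := by
      rcases mul_eq_zero.1 hp with ha | hd'
      · refine ⟨ha, ?_⟩
        have e2' := e2; rw [ha] at e2'; push_cast at e2'
        have : W * ((γ 1 1 : ℤ) : ℝ) = 0 := by linarith
        rcases mul_eq_zero.1 this with h | h
        · exact absurd h hW.ne'
        · exact_mod_cast h
      · refine ⟨?_, hd'⟩
        have e2' := e2; rw [hd'] at e2'; push_cast at e2'
        have : ((γ 0 0 : ℤ) : ℝ) * Y = 0 := by linarith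
        rcases mul_eq_zero.1 this with h | h
        · exact_mod_cast h
        · exact absurd h hY.ne'
    obtain ⟨ha, hd'⟩ := had0
    rcases Int.eq_one_or_neg_one_of_mul_eq_neg_one' hq with ⟨hb, hc⟩ | ⟨hb, hc⟩
    · refine Or.inr (Or.inr (Or.inr ?_))
      ext i j
      fin_cases i <;> fin_cases j <;> simp [ha, hb, hc, hd', ModularGroup.coe_S]
    · refine Or.inr (Or.inr (Or.inl ?_))
      ext i j
      fin_cases i <;> fin_cases j <;> simp [ha, hb, hc, hd', ModularGroup.coe_S]

/-- **`S = v` preserves `iC_1`**: `Re(S • τ) = 0` if `Re τ = 0` (`S(iY) = i/Y`).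
[cite: GoreskyTai2003RealModuli, §5 («`iC_1` is preserved by the subgroup `S′ = {±I, ±v}`»)] -/
theorem re_S_smul_eq_zero {τ : ℍ} (hτ : τ.re = 0) : (ModularGroup.S • τ).re = 0 := by
  rw [← UpperHalfPlane.coe_re, UpperHalfPlane.modular_S_smul, UpperHalfPlane.coe_mk, Complex.inv_re,
    Complex.neg_re, UpperHalfPlane.coe_re, hτ, neg_zero, zero_div]

/-- `Re((−γ) • τ) = Re(γ • τ)` (`−1` acts trivially). [cite: GoreskyTai2003RealModuli, §5 («`Γ(2)/±I`»)] -/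
theorem re_neg_smul (γ : SL(2, ℤ)) (τ : ℍ) : ((-γ) • τ).re = (γ • τ).re := by
  rw [ModularGroup.SL_neg_smul]

/-- The four elements of `S′` preserve `iC_1`. [cite: GoreskyTai2003RealModuli, §5 («`iC_1` is preserved by the subgroup `S′`»)] -/
theorem re_smul_eq_zero_of_mem_S' {γ : SL(2, ℤ)} (hγ : γ = 1 ∨ γ = -1 ∨ γ = ModularGroup.S ∨ γ = -ModularGroup.S)
    {τ : ℍ} (hτ : τ.re = 0) : (γ • τ).re = 0 := by
  rcases hγ with rfl | rfl | rfl | rfl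
  · rwa [one_smul]
  · rwa [re_neg_smul, one_smul]
  · exact re_S_smul_eq_zero hτ
  · rw [re_neg_smul]; exact re_S_smul_eq_zero hτ

/-- `±S ∉ Γ(2)`, `±1 ∈ Γ(2)`: **`S′ ∩ Γ(2) = {±1}`**. [cite: GoreskyTai2003RealModuli, §5 («the group `Γ(2)/±I` acts freely»)] -/
theorem S_not_mem_Gamma_two :
    ModularGroup.S ∉ CongruenceSubgroup.Gamma 2 ∧ -ModularGroup.S ∉ CongruenceSubgroup.Gamma 2 ∧
      (-1 : SL(2, ℤ)) ∈ CongruenceSubgroup.Gamma 2 := by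
  refine ⟨?_, ?_, ?_⟩
  · rw [CongruenceSubgroup.Gamma_mem]; decide
  · rw [CongruenceSubgroup.Gamma_mem]; decide
  · rw [CongruenceSubgroup.Gamma_mem]; decide

/-- **«The group `Γ(2)` does not induce any identifications on the cone `iC_1`»**: an element of `Γ(2)`
carrying a point of `iℝ₊` into `iℝ₊` is `±1`, and fixes the point.
[cite: GoreskyTai2003RealModuli, §5 (before Theorem 15)] -/
theorem smul_eq_self_of_mem_Gamma_two {γ : SL(2, ℤ)} (hγ : γ ∈ CongruenceSubgroup.Gamma 2) {τ : ℍ}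
    (hτ : τ.re = 0) (hγτ : (γ • τ).re = 0) : (γ = 1 ∨ γ = -1) ∧ γ • τ = τ := by
  have key : γ = 1 ∨ γ = -1 := by
    rcases eq_one_or_eq_neg_one_or_eq_S_or_eq_neg_S_of_re_smul_eq_zero hτ hγτ with h | h | h | h
    · exact Or.inl h
    · exact Or.inr h
    · exact absurd hγ (h ▸ S_not_mem_Gamma_two.1)
    · exact absurd hγ (h ▸ S_not_mem_Gamma_two.2.1)
  refine ⟨key, ?_⟩
  rcases key with rfl | rfl
  · rw [one_smul]
  · rw [ModularGroup.SL_neg_smul, one_smul]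

/-- `−conj z = z ⟺ Re z = 0`: the fixed points of `τ(z) = −z̄` in `ℍ` form the cone `iC_1 = iℝ₊`, so the
points of `iℝ₊` are `Γ(2)`-real with `γ = 1`. [cite: GoreskyTai2003RealModuli, §2.2 («Its fixed point set is … `iC_n`»), §5] -/
theorem neg_conj_coe_eq_self_iff (τ : ℍ) : -conj (τ : ℂ) = τ ↔ τ.re = 0 := by
  rw [← UpperHalfPlane.coe_re]
  constructor
  · intro h
    have := congrArg Complex.re h
    rw [Complex.neg_re, Complex.conj_re] at this
    linarith
  · intro h
    apply Complex.ext
    · rw [Complex.neg_re, Complex.conj_re, h, neg_zero]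
    · rw [Complex.neg_im, Complex.conj_im, neg_neg]

end Cone

/-! ## §4 `ω = ρ` and its translates are not `Γ(2)`-real («none of these matrices `js` lies in `Γ(2)`») -/

section Rho

/-- `−ρ̄ = ρ + 1 = T • ρ` («`ω̃ = −ω̄ = jω`»; in Mathlib's normalisation `T • ρ = S • ρ = 1 +ᵥ ρ`).
[cite: GoreskyTai2003RealModuli, §5 proof of Lemma 14] -/
theorem neg_conj_rho : -conj (UpperHalfPlane.ρ : ℂ) = ((ModularGroup.T • UpperHalfPlane.ρ : ℍ) : ℂ) := by
  rw [UpperHalfPlane.modular_T_smul, UpperHalfPlane.coe_vadd]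
  apply Complex.ext <;> norm_num [UpperHalfPlane.ρ]

/-- **`ω = ρ` IS NOT `Γ(2)`-REAL**: no `γ′ ∈ Γ(2)` has `γ′ • ρ = −ρ̄` — otherwise `T⁻¹γ′` stabilises `ρ`, so
`γ′ ∈ T · {±1, ±ST, ±T⁻¹S}`, and none of these six matrices is `≡ 1 (mod 2)` («So `j⁻¹γ′` stabilizes `ω` or
`γ′ = js` for some `s ∈ S`.  However none of these matrices `js` lies in `Γ(2)`»; Mathlib's `stabilizer_ρ`).
[cite: GoreskyTai2003RealModuli, §5 proof of Lemma 14, case (b)] -/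
theorem not_exists_mem_Gamma_two_smul_rho :
    ¬ ∃ γ ∈ CongruenceSubgroup.Gamma 2,
      ((γ • UpperHalfPlane.ρ : ℍ) : ℂ) = -conj (UpperHalfPlane.ρ : ℂ) := by
  rintro ⟨γ, hγ, h⟩
  rw [neg_conj_rho, ← UpperHalfPlane.ext_iff, ← inv_smul_eq_iff, ← mul_smul] at h
  have hmem := ModularGroup.stabilizer_ρ.1 h
  have hγeq : γ = ModularGroup.T * (ModularGroup.T⁻¹ * γ) := by group
  rw [hγeq] at hγ
  simp only [Finset.mem_insert, Finset.mem_singleton] at hmem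
  rcases hmem with e | e | e | e | e | e <;> rw [e, CongruenceSubgroup.Gamma_mem] at hγ <;> revert hγ <;> decide

/-- The same at the point `(ρ) ∈ 𝔥_1`: no `γ ∈ Γ_1(2)` has `ι(γ) • (ρ) = −(ρ̄)`.
[cite: GoreskyTai2003RealModuli, §5 proof of Lemma 14, case (b)] -/
theorem not_exists_mem_siegelPrincipalGamma_two_smul_one1_rho :
    ¬ ∃ γ ∈ siegelPrincipalGamma 1 2, symplecticIntHom 1 γ •
        (⟨one1 (UpperHalfPlane.ρ : ℂ), one1_coe_mem UpperHalfPlane.ρ⟩ : siegelUpperHalfSpace 1) =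
          ⟨-(one1 (UpperHalfPlane.ρ : ℂ)).map conj,
            neg_map_conj_mem_siegelUpperHalfSpace (one1_coe_mem UpperHalfPlane.ρ)⟩ := by
  rw [exists_mem_siegelPrincipalGamma_two_smul_one1_eq_negConj_iff]
  exact not_exists_mem_Gamma_two_smul_rho

/-- **NO TRANSLATE `β • ω` IS `Γ(2)`-REAL** («Suppose `y = gω` … We claim that `y` is not `Γ(2)`-real»): by
LEMMA 13 (g51-#9, `Γ(2)`-reality is a property of the `SL(2, ℤ)`-orbit — «`γ′ = g̃⁻¹γg = (g̃⁻¹g) g⁻¹γg ∈ Γ(2)`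
by Lemma 9») and §4. [cite: GoreskyTai2003RealModuli, §5 proof of Lemma 14, case (b), with Lemma 13] -/
theorem not_real_smul_rho (β : SL(2, ℤ)) :
    ¬ ∃ γ ∈ CongruenceSubgroup.Gamma 2,
      ((γ • β • UpperHalfPlane.ρ : ℍ) : ℂ) = -conj ((β • UpperHalfPlane.ρ : ℍ) : ℂ) := by
  intro h
  apply not_exists_mem_siegelPrincipalGamma_two_smul_one1_rho
  rw [← exists_mem_siegelPrincipalGamma_two_smul_smul_eq_negConj_iff (symplecticIntHom_spOfSL_mem β)]
  simp only [symplecticIntHom_spOfSL_smul_one1]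
  exact (exists_mem_siegelPrincipalGamma_two_smul_one1_eq_negConj_iff (β • UpperHalfPlane.ρ)).2 h

end Rho

/-! ## §5 LEMMA 14: a `Γ(2)`-real point of `𝔥_1` lies on a translate `β · iC_1`, `β ∈ SL(2, ℤ)` -/

section Lemma14

/-- **LEMMA 14 (Goresky–Tai), in `ℍ`.**  If `τ ∈ ℍ` is `(Γ(2), τ)`-real — `γ • τ = −τ̄` for some `γ ∈ Γ(2)` —
then `τ = β · iY` for some `β ∈ SL(2, ℤ)` and `Y > 0`, i.e. `Re(β⁻¹ • τ) = 0`.  Proof as printed: (a) if the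
stabiliser of `τ` in `SL(2, ℤ)` is `±1`, PROPOSITION 10 (g51-#5, at `g = 1` through the bridge of §1) gives an
integral `h` with `γ = τ(h)h⁻¹` and `𝔥_1^γ = h · iC_1 ∋ τ`; (b) otherwise `τ = β • i` (and `i ∈ iC_1`) or
`τ = β • ω`, which is not `Γ(2)`-real (§4). [cite: GoreskyTai2003RealModuli, §5 Lemma 14] -/
theorem exists_re_inv_smul_eq_zero_of_real {τ : ℍ}
    (h : ∃ γ ∈ CongruenceSubgroup.Gamma 2, ((γ • τ : ℍ) : ℂ) = -conj (τ : ℂ)) :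
    ∃ β : SL(2, ℤ), (β⁻¹ • τ).re = 0 := by
  by_cases hstab : ∀ g : SL(2, ℤ), g • τ = τ → g = 1 ∨ g = -1
  · -- case (a): Proposition 10 at `g = 1`
    obtain ⟨g, hg, hgτ⟩ := h
    have hstab' : ∀ P ∈ siegelModularGroup 1,
        P • (⟨one1 (τ : ℂ), one1_coe_mem τ⟩ : siegelUpperHalfSpace 1) = ⟨one1 (τ : ℂ), one1_coe_mem τ⟩ →
          (P : Matrix (Fin 1 ⊕ Fin 1) (Fin 1 ⊕ Fin 1) ℝ) = 1 ∨
            (P : Matrix (Fin 1 ⊕ Fin 1) (Fin 1 ⊕ Fin 1) ℝ) = -1 := by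
      intro P hP hfix
      obtain ⟨g', rfl⟩ := exists_eq_symplecticIntHom_spOfSL hP
      rw [symplecticIntHom_spOfSL_smul_one1_eq_one1_iff] at hfix
      rcases hstab g' hfix with rfl | rfl
      · exact Or.inl coe_symplecticIntHom_spOfSL_one
      · right; rw [coe_symplecticIntHom_spOfSL_neg, coe_symplecticIntHom_spOfSL_one]
    have hγ : (⟨spOfSL g, spOfSL_mem g⟩ : Matrix.symplecticGroup (Fin 1) ℤ) ∈ siegelPrincipalGamma 1 2 :=
      (mk_spOfSL_mem_siegelPrincipalGamma_iff g).2 hg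
    have hsmul := (symplecticIntHom_spOfSL_smul_one1_eq_negConj_iff g τ).2 hgτ
    obtain ⟨h, hh, -, hiff⟩ := exists_coboundary_of_mem_siegelPrincipalGamma_two (fun _ ↦ Nat.one_pos)
      (one1_coe_mem τ) Nat.one_pos hstab' hγ hsmul
    have hre := (hiff ⟨one1 (τ : ℂ), one1_coe_mem τ⟩).1 hsmul
    obtain ⟨β, rfl⟩ := exists_eq_symplecticIntHom_spOfSL hh
    refine ⟨β, ?_⟩
    rw [symplecticIntHom_spOfSL_inv, symplecticIntHom_spOfSL_smul_one1] at hre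
    exact (map_re_one1_coe_eq_zero_iff _).1 hre
  · -- case (b): `τ` is an elliptic point
    push Not at hstab
    obtain ⟨g, hgτ, hg1, hg2⟩ := hstab
    obtain ⟨β, hβ | hβ⟩ := exists_eq_smul_I_or_eq_smul_rho_of_smul_eq_self hgτ hg1 hg2
    · refine ⟨β, ?_⟩
      rw [hβ, inv_smul_smul]
      show UpperHalfPlane.I.re = 0
      rw [← UpperHalfPlane.coe_re]
      simp [UpperHalfPlane.I]
    · subst hβ
      exact absurd h (not_real_smul_rho β)

/-- **LEMMA 14 (Goresky–Tai), in `𝔥_1`.**  «If a point `y ∈ 𝔥_1` is `(Γ(2), τ)`-real, then there exists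
`β ∈ SL(2, ℤ)` and there exists `Y ∈ C_1 = ℝ₊` so that `y = β · iY`»: a `Γ_1(2)`-real `Ω ∈ 𝔥_1` lies on a slice
`β · iC_1` (`Re(β⁻¹ • Ω) = 0`), `β ∈ Γ_1 = Sp_2(ℤ)`. [cite: GoreskyTai2003RealModuli, §5 Lemma 14] -/
theorem exists_mem_siegelModularGroup_map_re_inv_smul_eq_zero_of_real {Ω : siegelUpperHalfSpace 1}
    (h : ∃ γ ∈ siegelPrincipalGamma 1 2, symplecticIntHom 1 γ • Ω =
      ⟨-(Ω : Matrix (Fin 1) (Fin 1) ℂ).map conj, neg_map_conj_mem_siegelUpperHalfSpace Ω.2⟩) :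
    ∃ β ∈ siegelModularGroup 1,
      ((β⁻¹ • Ω : siegelUpperHalfSpace 1) : Matrix (Fin 1) (Fin 1) ℂ).map Complex.re = 0 := by
  obtain ⟨τ, rfl⟩ := exists_eq_one1 Ω
  rw [exists_mem_siegelPrincipalGamma_two_smul_one1_eq_negConj_iff] at h
  obtain ⟨β, hβ⟩ := exists_re_inv_smul_eq_zero_of_real h
  refine ⟨symplecticIntHom 1 ⟨spOfSL β, spOfSL_mem β⟩, symplecticIntHom_spOfSL_mem β, ?_⟩
  rw [symplecticIntHom_spOfSL_inv, symplecticIntHom_spOfSL_smul_one1]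
  exact (map_re_one1_coe_eq_zero_iff _).2 hβ

end Lemma14

/-! ## §6 THEOREM 15: `X(2)_ℝ` is the union of three copies of `C_1 ≅ ℝ₊` indexed by `Γ(2)∖SL_2(ℤ)/S′` -/

section Theorem15

/-- **THE `Γ(2)`-REAL LOCUS OF `ℍ` IS EXACTLY `⋃_{β ∈ SL(2,ℤ)} β · iℝ₊`**: `τ` is `Γ(2)`-real iff
`Re(β⁻¹ • τ) = 0` for some `β ∈ SL(2, ℤ)` (⟹ LEMMA 14; ⟸: a point of `iℝ₊` is real with `γ = 1`, and
reality is `SL(2, ℤ)`-invariant by LEMMA 13). [cite: GoreskyTai2003RealModuli, §5 Lemma 13, Lemma 14, Theorem 15] -/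
theorem real_iff_exists_re_inv_smul_eq_zero (τ : ℍ) :
    (∃ γ ∈ CongruenceSubgroup.Gamma 2, ((γ • τ : ℍ) : ℂ) = -conj (τ : ℂ)) ↔
      ∃ β : SL(2, ℤ), (β⁻¹ • τ).re = 0 := by
  refine ⟨exists_re_inv_smul_eq_zero_of_real, ?_⟩
  rintro ⟨β, hβ⟩
  -- `β⁻¹ • τ ∈ iℝ₊` is real with `γ = 1` (a `τ`-fixed point); transport by Lemma 13 along `β`, in `𝔥_1`
  apply (exists_mem_siegelPrincipalGamma_two_smul_one1_eq_negConj_iff τ).1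
  have key := (exists_mem_siegelPrincipalGamma_two_smul_smul_eq_negConj_iff (symplecticIntHom_spOfSL_mem β)
    (⟨one1 ((β⁻¹ • τ : ℍ) : ℂ), one1_coe_mem (β⁻¹ • τ)⟩ : siegelUpperHalfSpace 1)).2
    ⟨1, Subgroup.one_mem _, by
      rw [map_one, one_smul]
      exact Subtype.ext ((neg_map_conj_eq_self_iff _).2 ((map_re_one1_coe_eq_zero_iff _).2 hβ)).symm⟩
  simpa only [symplecticIntHom_spOfSL_smul_one1, smul_inv_smul] using key

/-- **THEOREM 15 (i), in `𝔥_1`: the `Γ_1(2)`-real locus is `S(2) = ⋃_{β ∈ Γ_1} β · iC_1`** — `Ω ∈ 𝔥_1` is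
`Γ_1(2)`-real iff `Re(β⁻¹ • Ω) = 0` for some `β ∈ Γ_1 = Sp_2(ℤ)`.
[cite: GoreskyTai2003RealModuli, §5 Lemma 14, Theorem 15] -/
theorem real_iff_exists_mem_siegelModularGroup_map_re_inv_smul_eq_zero (Ω : siegelUpperHalfSpace 1) :
    (∃ γ ∈ siegelPrincipalGamma 1 2, symplecticIntHom 1 γ • Ω =
        ⟨-(Ω : Matrix (Fin 1) (Fin 1) ℂ).map conj, neg_map_conj_mem_siegelUpperHalfSpace Ω.2⟩) ↔
      ∃ β ∈ siegelModularGroup 1,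
        ((β⁻¹ • Ω : siegelUpperHalfSpace 1) : Matrix (Fin 1) (Fin 1) ℂ).map Complex.re = 0 := by
  refine ⟨exists_mem_siegelModularGroup_map_re_inv_smul_eq_zero_of_real, ?_⟩
  rintro ⟨β, hβ, hre⟩
  -- `β⁻¹ • Ω` is `τ`-fixed, hence real with `γ = 1`; Lemma 13 along `β`
  have h0 : ∃ γ ∈ siegelPrincipalGamma 1 2, symplecticIntHom 1 γ • (β⁻¹ • Ω) =
      ⟨-((β⁻¹ • Ω : siegelUpperHalfSpace 1) : Matrix (Fin 1) (Fin 1) ℂ).map conj,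
        neg_map_conj_mem_siegelUpperHalfSpace (β⁻¹ • Ω).2⟩ :=
    ⟨1, Subgroup.one_mem _, by rw [map_one, one_smul]; exact Subtype.ext ((neg_map_conj_eq_self_iff _).2 hre).symm⟩
  have h1 := (exists_mem_siegelPrincipalGamma_two_smul_smul_eq_negConj_iff hβ (β⁻¹ • Ω)).2 h0
  rwa [smul_inv_smul] at h1

/-- **THEOREM 15 (ii), in `𝔥_1`: an element of `Γ_1 = Sp_2(ℤ)` carrying a point of `iC_1` into `iC_1` is
`±1` or `±J`** («`iC_1` is preserved by the subgroup `S′ = {±I, ±v}`»; `ι(spOfSL S) = J`).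
[cite: GoreskyTai2003RealModuli, §5 (before Theorem 15)] -/
theorem coe_eq_of_map_re_eq_zero_of_map_re_smul_eq_zero {P : Matrix.symplecticGroup (Fin 1) ℝ}
    (hP : P ∈ siegelModularGroup 1) {Ω : siegelUpperHalfSpace 1}
    (hΩ : (Ω : Matrix (Fin 1) (Fin 1) ℂ).map Complex.re = 0)
    (hPΩ : ((P • Ω : siegelUpperHalfSpace 1) : Matrix (Fin 1) (Fin 1) ℂ).map Complex.re = 0) :
    (P : Matrix (Fin 1 ⊕ Fin 1) (Fin 1 ⊕ Fin 1) ℝ) = 1 ∨ (P : Matrix (Fin 1 ⊕ Fin 1) (Fin 1 ⊕ Fin 1) ℝ) = -1 ∨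
      (P : Matrix (Fin 1 ⊕ Fin 1) (Fin 1 ⊕ Fin 1) ℝ) = Matrix.J (Fin 1) ℝ ∨
        (P : Matrix (Fin 1 ⊕ Fin 1) (Fin 1 ⊕ Fin 1) ℝ) = -Matrix.J (Fin 1) ℝ := by
  obtain ⟨γ, rfl⟩ := exists_eq_symplecticIntHom_spOfSL hP
  obtain ⟨τ, rfl⟩ := exists_eq_one1 Ω
  rw [symplecticIntHom_spOfSL_smul_one1] at hPΩ
  have hτ := (map_re_one1_coe_eq_zero_iff τ).1 hΩ
  have hγτ := (map_re_one1_coe_eq_zero_iff (γ • τ)).1 hPΩ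
  rcases eq_one_or_eq_neg_one_or_eq_S_or_eq_neg_S_of_re_smul_eq_zero hτ hγτ with rfl | rfl | rfl | rfl
  · exact Or.inl coe_symplecticIntHom_spOfSL_one
  · exact Or.inr (Or.inl (by rw [coe_symplecticIntHom_spOfSL_neg, coe_symplecticIntHom_spOfSL_one]))
  · exact Or.inr (Or.inr (Or.inl coe_symplecticIntHom_spOfSL_S))
  · exact Or.inr (Or.inr (Or.inr (by rw [coe_symplecticIntHom_spOfSL_neg, coe_symplecticIntHom_spOfSL_S])))

/-- **THEOREM 15 (ii′), in `𝔥_1`: «`Γ(2)` does not induce any identifications on the cone `iC_1`»** — an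
element of `Γ_1(2)` carrying a point of `iC_1` into `iC_1` fixes it.
[cite: GoreskyTai2003RealModuli, §5 (before Theorem 15)] -/
theorem smul_eq_self_of_mem_siegelPrincipalGamma_two_of_map_re_eq_zero {γ : Matrix.symplecticGroup (Fin 1) ℤ}
    (hγ : γ ∈ siegelPrincipalGamma 1 2) {Ω : siegelUpperHalfSpace 1}
    (hΩ : (Ω : Matrix (Fin 1) (Fin 1) ℂ).map Complex.re = 0)
    (hγΩ : ((symplecticIntHom 1 γ • Ω : siegelUpperHalfSpace 1) : Matrix (Fin 1) (Fin 1) ℂ).map Complex.re = 0) :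
    symplecticIntHom 1 γ • Ω = Ω := by
  obtain ⟨τ, rfl⟩ := exists_eq_one1 Ω
  rw [← mk_spOfSL_slOfSp γ] at hγ hγΩ ⊢
  rw [mk_spOfSL_mem_siegelPrincipalGamma_iff] at hγ
  rw [symplecticIntHom_spOfSL_smul_one1] at hγΩ ⊢
  have hτ := (map_re_one1_coe_eq_zero_iff τ).1 hΩ
  have hγτ := (map_re_one1_coe_eq_zero_iff _).1 hγΩ
  have hfix := (smul_eq_self_of_mem_Gamma_two hγ hτ hγτ).2
  exact Subtype.ext (by rw [hfix])

/-- **The index set `Γ(2)∖SL_2(ℤ)/S′`, (a): two slices `β · iℝ₊` and `β′ · iℝ₊` are identified by `Γ(2)`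
(some `γ ∈ Γ(2)` carries a point of the first to a point of the second) iff `β′ ∈ Γ(2) β S′`** — and since
`−1 ∈ Γ(2)`, iff `β′ = γβ` or `β′ = γβS` with `γ ∈ Γ(2)` (§3: the element `β′⁻¹γβ` carries `iℝ₊` into `iℝ₊`,
so it lies in `S′`). [cite: GoreskyTai2003RealModuli, §5 Theorem 15 («`X_ℝ = ⋃_{β ∈ Γ(2)∖SL_2(ℤ)/S′} β·iC_1`»)] -/
theorem exists_mem_Gamma_two_smul_smul_eq_smul_iff (β β' : SL(2, ℤ)) :
    (∃ γ ∈ CongruenceSubgroup.Gamma 2, ∃ τ τ' : ℍ, τ.re = 0 ∧ τ'.re = 0 ∧ γ • β • τ = β' • τ') ↔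
      ∃ γ ∈ CongruenceSubgroup.Gamma 2, β' = γ * β ∨ β' = γ * β * ModularGroup.S := by
  constructor
  · rintro ⟨γ, hγ, τ, τ', hτ, hτ', h⟩
    have h' : (β'⁻¹ * γ * β) • τ = τ' := by
      rw [mul_smul, mul_smul, h, inv_smul_smul]
    have hre : ((β'⁻¹ * γ * β) • τ).re = 0 := by rw [h']; exact hτ'
    rcases eq_one_or_eq_neg_one_or_eq_S_or_eq_neg_S_of_re_smul_eq_zero hτ hre with e | e | e | e
    · refine ⟨γ, hγ, Or.inl ?_⟩
      rw [mul_assoc, inv_mul_eq_one] at e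
      exact e
    · have hnγ : -γ ∈ CongruenceSubgroup.Gamma 2 := by
        rw [← neg_one_mul]; exact (CongruenceSubgroup.Gamma 2).mul_mem S_not_mem_Gamma_two.2.2 hγ
      refine ⟨-γ, hnγ, Or.inl ?_⟩
      rw [mul_assoc, inv_mul_eq_iff_eq_mul, mul_neg, mul_one] at e
      rw [neg_mul, e, neg_neg]
    · -- `β′⁻¹γβ = S`: `γβ = β′S ⟹ β′ = γβS⁻¹ = (−γ)βS`
      have hnγ : -γ ∈ CongruenceSubgroup.Gamma 2 := by
        rw [← neg_one_mul]; exact (CongruenceSubgroup.Gamma 2).mul_mem S_not_mem_Gamma_two.2.2 hγ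
      refine ⟨-γ, hnγ, Or.inr ?_⟩
      rw [mul_assoc, inv_mul_eq_iff_eq_mul] at e
      have hS : ModularGroup.S * ModularGroup.S = (-1 : SL(2, ℤ)) := by decide
      calc β' = -(β' * ModularGroup.S * ModularGroup.S) := by rw [mul_assoc, hS, mul_neg, mul_one, neg_neg]
        _ = -γ * β * ModularGroup.S := by rw [← e, neg_mul, neg_mul]
    · -- `β′⁻¹γβ = −S`: `γβ = β′(−S) ⟹ β′ = γβS`
      refine ⟨γ, hγ, Or.inr ?_⟩
      rw [mul_assoc, inv_mul_eq_iff_eq_mul] at e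
      have hS : ModularGroup.S * ModularGroup.S = (-1 : SL(2, ℤ)) := by decide
      calc β' = -(β' * ModularGroup.S * ModularGroup.S) := by rw [mul_assoc, hS, mul_neg, mul_one, neg_neg]
        _ = β' * -ModularGroup.S * ModularGroup.S := by rw [mul_neg β' ModularGroup.S, neg_mul]
        _ = γ * β * ModularGroup.S := by rw [← e]
  · have hI : UpperHalfPlane.I.re = 0 := by rw [← UpperHalfPlane.coe_re]; simp [UpperHalfPlane.I]
    rintro ⟨γ, hγ, h | h⟩
    · exact ⟨γ, hγ, UpperHalfPlane.I, UpperHalfPlane.I, hI, hI, by rw [h, mul_smul]⟩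
    · exact ⟨γ, hγ, ModularGroup.S • UpperHalfPlane.I, UpperHalfPlane.I, re_S_smul_eq_zero hI, hI,
        by rw [h, mul_smul, mul_smul]⟩

/-- **The index set `Γ(2)∖SL_2(ℤ)/S′`, (b): by reduction modulo `2`** — `β′ ∈ Γ(2) β S′` iff `β′ ≡ β` or
`β′ ≡ βS (mod 2)` in `SL(2, ℤ/2)` (`Γ(2)` is the kernel of `SL(2, ℤ) → SL(2, ℤ/2)`).
[cite: GoreskyTai2003RealModuli, §4.1 («`Γ(N) = {γ ∈ Γ(1) | γ ≡ I (mod N)}`»), §5 Theorem 15] -/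
theorem exists_mem_Gamma_two_eq_mul_iff_map_eq (β β' : SL(2, ℤ)) :
    (∃ γ ∈ CongruenceSubgroup.Gamma 2, β' = γ * β ∨ β' = γ * β * ModularGroup.S) ↔
      Matrix.SpecialLinearGroup.map (Int.castRingHom (ZMod 2)) β' =
          Matrix.SpecialLinearGroup.map (Int.castRingHom (ZMod 2)) β ∨
        Matrix.SpecialLinearGroup.map (Int.castRingHom (ZMod 2)) β' =
          Matrix.SpecialLinearGroup.map (Int.castRingHom (ZMod 2)) β *
            Matrix.SpecialLinearGroup.map (Int.castRingHom (ZMod 2)) ModularGroup.S := by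
  constructor
  · rintro ⟨γ, hγ, h | h⟩
    · left; rw [h, map_mul, CongruenceSubgroup.Gamma_mem'.1 hγ, one_mul]
    · right; rw [h, map_mul, map_mul, CongruenceSubgroup.Gamma_mem'.1 hγ, one_mul]
  · rintro (h | h)
    · refine ⟨β' * β⁻¹, CongruenceSubgroup.Gamma_mem'.2 ?_, Or.inl (by group)⟩
      rw [map_mul, map_inv, h, mul_inv_cancel]
    · refine ⟨β' * ModularGroup.S⁻¹ * β⁻¹, CongruenceSubgroup.Gamma_mem'.2 ?_, Or.inr (by group)⟩
      rw [map_mul, map_mul, map_inv, map_inv, h]; group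

/-- **The index set `Γ(2)∖SL_2(ℤ)/S′, (c): THREE classes, with representatives `1`, `T`, `ST`** —
`SL(2, ℤ/2)` has six elements `{1, S, T, TS, ST, STS} (mod 2)`, paired by right multiplication with `S`.
[cite: GoreskyTai2003RealModuli, §5 Theorem 15 («the union of 3 copies of the cone `C_1`»)] -/
theorem exists_mem_Gamma_two_eq_rep_mul (β : SL(2, ℤ)) :
    ∃ γ ∈ CongruenceSubgroup.Gamma 2, ∃ r : SL(2, ℤ),
      (r = 1 ∨ r = ModularGroup.T ∨ r = ModularGroup.S * ModularGroup.T) ∧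
        (β = γ * r ∨ β = γ * r * ModularGroup.S) := by
  have h6 : ∀ x : SL(2, ZMod 2),
      x = 1 ∨ x = Matrix.SpecialLinearGroup.map (Int.castRingHom (ZMod 2)) ModularGroup.S ∨
      x = Matrix.SpecialLinearGroup.map (Int.castRingHom (ZMod 2)) ModularGroup.T ∨
      x = Matrix.SpecialLinearGroup.map (Int.castRingHom (ZMod 2)) (ModularGroup.T * ModularGroup.S) ∨
      x = Matrix.SpecialLinearGroup.map (Int.castRingHom (ZMod 2)) (ModularGroup.S * ModularGroup.T) ∨
      x = Matrix.SpecialLinearGroup.map (Int.castRingHom (ZMod 2))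
        (ModularGroup.S * ModularGroup.T * ModularGroup.S) := by
    decide
  have aux : ∀ r : SL(2, ℤ), (r = 1 ∨ r = ModularGroup.T ∨ r = ModularGroup.S * ModularGroup.T) →
      (Matrix.SpecialLinearGroup.map (Int.castRingHom (ZMod 2)) β =
          Matrix.SpecialLinearGroup.map (Int.castRingHom (ZMod 2)) r ∨
        Matrix.SpecialLinearGroup.map (Int.castRingHom (ZMod 2)) β =
          Matrix.SpecialLinearGroup.map (Int.castRingHom (ZMod 2)) r *
            Matrix.SpecialLinearGroup.map (Int.castRingHom (ZMod 2)) ModularGroup.S) →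
      ∃ γ ∈ CongruenceSubgroup.Gamma 2, ∃ r : SL(2, ℤ),
        (r = 1 ∨ r = ModularGroup.T ∨ r = ModularGroup.S * ModularGroup.T) ∧
          (β = γ * r ∨ β = γ * r * ModularGroup.S) := by
    intro r hr h
    obtain ⟨γ, hγ, h'⟩ := (exists_mem_Gamma_two_eq_mul_iff_map_eq r β).2 h
    exact ⟨γ, hγ, r, hr, h'⟩
  rcases h6 (Matrix.SpecialLinearGroup.map (Int.castRingHom (ZMod 2)) β) with h | h | h | h | h | h
  · exact aux 1 (Or.inl rfl) (Or.inl (by rw [h, map_one]))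
  · exact aux 1 (Or.inl rfl) (Or.inr (by rw [h, map_one, one_mul]))
  · exact aux _ (Or.inr (Or.inl rfl)) (Or.inl h)
  · exact aux _ (Or.inr (Or.inl rfl)) (Or.inr (by simp only [h, map_mul]))
  · exact aux _ (Or.inr (Or.inr rfl)) (Or.inl h)
  · exact aux _ (Or.inr (Or.inr rfl)) (Or.inr (by simp only [h, map_mul]))

/-- **The three classes are distinct**: `T ∉ Γ(2)·1·S′`, `ST ∉ Γ(2)·1·S′`, `ST ∉ Γ(2)·T·S′`.
[cite: GoreskyTai2003RealModuli, §5 Theorem 15 («3 copies»)] -/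
theorem not_exists_mem_Gamma_two_rep_eq_mul :
    (¬ ∃ γ ∈ CongruenceSubgroup.Gamma 2, ModularGroup.T = γ * 1 ∨ ModularGroup.T = γ * 1 * ModularGroup.S) ∧
    (¬ ∃ γ ∈ CongruenceSubgroup.Gamma 2, ModularGroup.S * ModularGroup.T = γ * 1 ∨
        ModularGroup.S * ModularGroup.T = γ * 1 * ModularGroup.S) ∧
    (¬ ∃ γ ∈ CongruenceSubgroup.Gamma 2, ModularGroup.S * ModularGroup.T = γ * ModularGroup.T ∨
        ModularGroup.S * ModularGroup.T = γ * ModularGroup.T * ModularGroup.S) := by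
  refine ⟨?_, ?_, ?_⟩ <;> rw [exists_mem_Gamma_two_eq_mul_iff_map_eq] <;> decide

/-- **THEOREM 15 (Goresky–Tai): «`X_ℝ = ⋃_{β ∈ Γ(2)∖SL_2(ℤ)/S′} β · iC_1`», the union over THREE double
cosets** — every `Γ(2)`-real `τ ∈ ℍ` is `γ • r • τ₀` with `γ ∈ Γ(2)`, `r ∈ {1, T, ST}` and `τ₀ ∈ iℝ₊`: the
real locus of `X(2) = Γ(2)∖ℍ` is covered by the images of the three slices `iℝ₊`, `T · iℝ₊`, `ST · iℝ₊`.
[cite: GoreskyTai2003RealModuli, §5 Theorem 15] -/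
theorem exists_mem_Gamma_two_eq_smul_rep_smul_of_real {τ : ℍ}
    (h : ∃ γ ∈ CongruenceSubgroup.Gamma 2, ((γ • τ : ℍ) : ℂ) = -conj (τ : ℂ)) :
    ∃ γ ∈ CongruenceSubgroup.Gamma 2, ∃ r : SL(2, ℤ),
      (r = 1 ∨ r = ModularGroup.T ∨ r = ModularGroup.S * ModularGroup.T) ∧
        ∃ τ₀ : ℍ, τ₀.re = 0 ∧ τ = γ • r • τ₀ := by
  obtain ⟨β, hβ⟩ := exists_re_inv_smul_eq_zero_of_real h
  obtain ⟨γ, hγ, r, hr, hβr | hβr⟩ := exists_mem_Gamma_two_eq_rep_mul β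
  · exact ⟨γ, hγ, r, hr, β⁻¹ • τ, hβ, by rw [← mul_smul, ← hβr, smul_inv_smul]⟩
  · exact ⟨γ, hγ, r, hr, ModularGroup.S • β⁻¹ • τ, re_S_smul_eq_zero hβ, by
      rw [← mul_smul, ← mul_smul, ← hβr, smul_inv_smul]⟩

/-- **THEOREM 15, the three copies are not identified**: no `γ ∈ Γ(2)` carries a point of one of the slices
`iℝ₊`, `T · iℝ₊`, `ST · iℝ₊` to a point of another.
[cite: GoreskyTai2003RealModuli, §5 Theorem 15 («3 copies of the cone `C_1 ≅ ℝ₊`»)] -/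
theorem not_exists_mem_Gamma_two_smul_rep_smul_eq :
    (¬ ∃ γ ∈ CongruenceSubgroup.Gamma 2, ∃ τ τ' : ℍ, τ.re = 0 ∧ τ'.re = 0 ∧
        γ • (1 : SL(2, ℤ)) • τ = ModularGroup.T • τ') ∧
    (¬ ∃ γ ∈ CongruenceSubgroup.Gamma 2, ∃ τ τ' : ℍ, τ.re = 0 ∧ τ'.re = 0 ∧
        γ • (1 : SL(2, ℤ)) • τ = (ModularGroup.S * ModularGroup.T) • τ') ∧
    (¬ ∃ γ ∈ CongruenceSubgroup.Gamma 2, ∃ τ τ' : ℍ, τ.re = 0 ∧ τ'.re = 0 ∧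
        γ • ModularGroup.T • τ = (ModularGroup.S * ModularGroup.T) • τ') := by
  refine ⟨?_, ?_, ?_⟩ <;> rw [exists_mem_Gamma_two_smul_smul_eq_smul_iff]
  · simpa only [mul_one] using not_exists_mem_Gamma_two_rep_eq_mul.1
  · simpa only [mul_one] using not_exists_mem_Gamma_two_rep_eq_mul.2.1
  · exact not_exists_mem_Gamma_two_rep_eq_mul.2.2

/-- **THEOREM 15, each copy is a copy of `C_1 ≅ ℝ₊`**: inside a slice `β · iℝ₊` the group `Γ(2)` induces no
identifications — if `γ ∈ Γ(2)` carries `β • τ₀` to `β • τ₁` (`τ₀, τ₁ ∈ iℝ₊`) then `τ₁ = τ₀` (the element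
`β⁻¹γβ ∈ Γ(2)` preserves `iℝ₊`, §3). [cite: GoreskyTai2003RealModuli, §5 («`Γ(2)` does not induce any identifications on the cone `iC_1`»), Theorem 15] -/
theorem eq_of_mem_Gamma_two_smul_smul_eq_smul {γ : SL(2, ℤ)} (hγ : γ ∈ CongruenceSubgroup.Gamma 2)
    (β : SL(2, ℤ)) {τ₀ τ₁ : ℍ} (h₀ : τ₀.re = 0) (h₁ : τ₁.re = 0) (h : γ • β • τ₀ = β • τ₁) : τ₁ = τ₀ := by
  have h' : (β⁻¹ * γ * β) • τ₀ = τ₁ := by rw [mul_smul, mul_smul, h, inv_smul_smul]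
  have hmem : β⁻¹ * γ * β ∈ CongruenceSubgroup.Gamma 2 := by
    have := (CongruenceSubgroup.Gamma_normal 2).conj_mem γ hγ β⁻¹
    rwa [inv_inv] at this
  have hre : ((β⁻¹ * γ * β) • τ₀).re = 0 := by rw [h']; exact h₁
  rw [← h', (smul_eq_self_of_mem_Gamma_two hmem h₀ hre).2]

end Theorem15

end SiegelModuli

end Literature.AlgebraicGeometry.ModuliOfAbelianVarieties
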